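import Mathlib.RingTheory.AdjoinRoot
import Mathlib.RingTheory.Norm.Basic
import Mathlib.RingTheory.Polynomial.UniqueFactorization
import Mathlib.RingTheory.IntegralClosure.IntegrallyClosed
import Mathlib.RingTheory.Polynomial.RationalRoot
import Mathlib.RingTheory.Localization.FractionRing
import Mathlib.RingTheory.MvPolynomial.Basic
import Mathlib.Algebra.Polynomial.SpecificDegree
import Mathlib.Algebra.CharP.Basic
import HarnessLib

/-!
# (A5b) THE DIAGONAL BRIESKORN–PHAM COMPLETE-INTERSECTION PAIR `F₁ = x₀²+x₁³+x₂³+x₃⁴+x₄⁵+x₅⁵`, `F₂ = x₀²+2x₁³+3x₂³+4x₃⁴+5x₄⁵+6x₅⁵` GENERATES A PRIME IDEAL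
# of `k[x₀, …, x₅]`, `k` ANY field of characteristic `p ≥ 7`
# (crux `FInjectiveMacaulayfication` stmt-ResolutionOfSingularities-15315, chain w45a; res-L1-w45a-plan-1 RULING R23.3 (A5) «bed = the diagonal Brieskorn–Pham CI pair …
# certified in-Lean»; seat res-L1-w45a-stub-2 g12)

[OURS · L1 W4.5a] Support file (`--supports stmt-ResolutionOfSingularities-15315 --as helper`); def-free; UNCONDITIONAL; no named fact, no sorry; NOT a statement of
any manuscript; replaces the role of NO printed item. Nothing of the crux is proved. AI-written (AI review weaker than expert review).

THE ARGUMENT. `(F₁, F₂) = (P, Q)` with `P = 2F₁ − F₂ = x₀² − G`, `Q = F₂ − F₁ = x₁³ + H`, `G = x₂³+2x₃⁴+3x₄⁵+4x₅⁵`, `H = 2x₂³+3x₃⁴+4x₄⁵+5x₅⁵ ∈ C = k[x₂..x₅]`. The MONIC TOWER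
`T₁ = C[X]/(X³ + H)`, `T₂ = T₁[X]/(X² − G)` is a DOMAIN: (§1) for a monic `f ∈ D[X]` and an injection `D ↪ L`, `D[X]/(f) ↪ L[X]/(f)` (reduce modulo the monic `f`), so
`D[X]/(f)` is a domain as soon as `f` is irreducible over the FIELD `L`; (§2) in `C` there is no `y` with `y³ = −H` or `y² = G` (specialise `x₂, x₃, x₅ ↦ 0`, `x₄ ↦ t`:
`3·deg = 5`, `2·deg = 5`); (§3) `X³ + H` has no root in `K₀ = Frac C` (a root is integral over the integrally closed `C`), so it is irreducible over `K₀` and `T₁ ↪ L₁ =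
K₀[X]/(X³+H)`, a cubic field; (§4) `X² − G` has no root `σ ∈ L₁`: `N_{L₁/K₀}(σ)² = N(G) = G³` would make `G = (N(σ)/G)²` a square in `K₀`, hence in `C`; so `T₂` is a
domain; (§5) `x₀ ↦ X̄₂, x₁ ↦ X̄₁, x_{m+2} ↦ x_{m+2}` defines `Φ : k[x] → T₂` killing `F₁, F₂`, the universal properties give `Ψ : T₂ → k[x]/(F₁, F₂)` with `Ψ ∘ Φ = mk`,
so `ker Φ = (F₁, F₂)` is PRIME (★ `isPrime_span_pair`). Constants `3, 4 ≠ 0` are used (`char k ≥ 7` suffices and is what the census row assumes).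
[cite: Matsumura1987, Thm. 9.1 (integrally closed domains; UFDs are normal)] [folklore: Gauss / norm argument]
-/

-- single-problem summit: the doubled namespace component is forced
set_option linter.dupNamespace false

noncomputable section

open Polynomial

namespace Summit.ResolutionOfSingularities.ResolutionOfSingularities.Theorems.FInjectiveMacaulayfication.DiagonalBPCIPrime

/-! ## §1 Monic extensions embed along injections of the base -/

/-- **REDUCTION MODULO A MONIC IS COMPATIBLE WITH BASE INJECTIONS**: for `f ∈ D[X]` monic and `φ : D ↪ L` (`L` non-trivial), a ring map `ρ : D[X]/(f) → L[X]/(f^φ)` over `φ`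
with `ρ(X̄) = X̄` is injective. [folklore] -/
theorem injective_of_monic {D L : Type} [CommRing D] [CommRing L] [Nontrivial L] (φ : D →+* L) (hφ : Function.Injective φ) (f : D[X]) (hf : f.Monic)
    (ρ : AdjoinRoot f →+* AdjoinRoot (f.map φ)) (hρC : ∀ d : D, ρ (AdjoinRoot.of f d) = AdjoinRoot.of (f.map φ) (φ d))
    (hρX : ρ (AdjoinRoot.root f) = AdjoinRoot.root (f.map φ)) : Function.Injective ρ := by
  rw [injective_iff_map_eq_zero]
  intro x hx
  obtain ⟨q, rfl⟩ := AdjoinRoot.mk_surjective x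
  -- `ρ (mk f q) = mk (f^φ) (q^φ)`
  have hρ : ρ (AdjoinRoot.mk f q) = AdjoinRoot.mk (f.map φ) (q.map φ) := by
    have hcomp : ρ.comp (AdjoinRoot.of f) = (AdjoinRoot.of (f.map φ)).comp φ := RingHom.ext fun d => by simp [hρC]
    rw [← AdjoinRoot.aeval_eq, Polynomial.aeval_def, AdjoinRoot.algebraMap_eq, Polynomial.hom_eval₂, hcomp, hρX, ← Polynomial.eval₂_map,
      ← AdjoinRoot.algebraMap_eq, ← Polynomial.aeval_def, AdjoinRoot.aeval_eq]
  rw [hρ, AdjoinRoot.mk_eq_zero] at hx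
  -- reduce `q` modulo the monic `f`
  have hmod : (q %ₘ f).map φ = 0 := by
    rw [Polynomial.map_modByMonic φ hf, Polynomial.modByMonic_eq_zero_iff_dvd (hf.map φ)]
    exact hx
  rw [Polynomial.map_eq_zero_iff hφ, Polynomial.modByMonic_eq_zero_iff_dvd hf] at hmod
  exact AdjoinRoot.mk_eq_zero.mpr hmod

/-- The comparison map `D[X]/(f) → L[X]/(f^φ)` over `φ` with `X̄ ↦ X̄` exists. [plumbing] -/
theorem exists_hom_of_monic {D L : Type} [CommRing D] [CommRing L] (φ : D →+* L) (f : D[X]) :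
    ∃ ρ : AdjoinRoot f →+* AdjoinRoot (f.map φ), (∀ d : D, ρ (AdjoinRoot.of f d) = AdjoinRoot.of (f.map φ) (φ d)) ∧
      ρ (AdjoinRoot.root f) = AdjoinRoot.root (f.map φ) := by
  refine ⟨AdjoinRoot.lift ((AdjoinRoot.of (f.map φ)).comp φ) (AdjoinRoot.root (f.map φ)) ?_, fun d => ?_, ?_⟩
  · rw [← Polynomial.eval₂_map, ← AdjoinRoot.algebraMap_eq, ← Polynomial.aeval_def, AdjoinRoot.aeval_eq, AdjoinRoot.mk_self]
  · rw [AdjoinRoot.lift_of, RingHom.comp_apply]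
  · rw [AdjoinRoot.lift_root]

/-- ★ **`D[X]/(f)` IS A DOMAIN when `f` is monic and irreducible over a FIELD `L ⊇ D`.** [folklore] -/
theorem isDomain_adjoinRoot_of_irreducible_map {D L : Type} [CommRing D] [Field L] (φ : D →+* L) (hφ : Function.Injective φ) (f : D[X]) (hf : f.Monic)
    (hirr : Irreducible (f.map φ)) : IsDomain (AdjoinRoot f) := by
  haveI := Fact.mk hirr
  obtain ⟨ρ, hρC, hρX⟩ := exists_hom_of_monic φ f
  exact Function.Injective.isDomain ρ (injective_of_monic φ hφ f hf ρ hρC hρX)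

/-- In a CUBIC extension `L/K`, if `γ ∈ K×` becomes a square `σ² = γ` in `L`, then `γ = (N_{L/K}(σ)/γ)²` is already a square in `K` (`N(σ)² = N(γ) = γ³`). [folklore] -/
theorem sq_eq_of_sq_eq_algebraMap {K L : Type} [Field K] [Field L] [Algebra K L] (h3 : Module.finrank K L = 3) (γ : K) (hγ : γ ≠ 0) (σ : L)
    (hσ : σ ^ 2 = algebraMap K L γ) : (Algebra.norm K σ / γ) ^ 2 = γ := by
  have hN : Algebra.norm K σ ^ 2 = γ ^ 3 := by rw [← map_pow, hσ, Algebra.norm_algebraMap, h3]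
  rw [div_pow, hN]
  field_simp

/-! ## §2 `C = k[x₂, x₃, x₄, x₅]`: `−H` is not a cube, `G` is not a square (specialise `x₂, x₃, x₅ ↦ 0`, `x₄ ↦ t`) -/

variable (k : Type) [Field k]

/-- `s(H) = 4t⁵` under `X 0, X 1, X 3 ↦ 0`, `X 2 ↦ t`. [plumbing] -/
theorem spec_H (H : MvPolynomial (Fin 4) k) (hH : H = MvPolynomial.C 2 * MvPolynomial.X 0 ^ 3 + MvPolynomial.C 3 * MvPolynomial.X 1 ^ 4 +
      MvPolynomial.C 4 * MvPolynomial.X 2 ^ 5 + MvPolynomial.C 5 * MvPolynomial.X 3 ^ 5) :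
    MvPolynomial.eval₂Hom (Polynomial.C : k →+* k[X]) (fun m : Fin 4 => if m = 2 then (Polynomial.X : k[X]) else 0) H = Polynomial.C 4 * Polynomial.X ^ 5 := by
  rw [hH]
  simp only [map_add, map_mul, map_pow, MvPolynomial.eval₂Hom_X', MvPolynomial.eval₂Hom_C]
  simp

/-- `s(G) = 3t⁵` under `X 0, X 1, X 3 ↦ 0`, `X 2 ↦ t`. [plumbing] -/
theorem spec_G (G : MvPolynomial (Fin 4) k) (hG : G = MvPolynomial.X 0 ^ 3 + MvPolynomial.C 2 * MvPolynomial.X 1 ^ 4 +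
      MvPolynomial.C 3 * MvPolynomial.X 2 ^ 5 + MvPolynomial.C 4 * MvPolynomial.X 3 ^ 5) :
    MvPolynomial.eval₂Hom (Polynomial.C : k →+* k[X]) (fun m : Fin 4 => if m = 2 then (Polynomial.X : k[X]) else 0) G = Polynomial.C 3 * Polynomial.X ^ 5 := by
  rw [hG]
  simp only [map_add, map_mul, map_pow, MvPolynomial.eval₂Hom_X', MvPolynomial.eval₂Hom_C]
  simp

/-- **`−H` is not a cube in `C`** (`4 ≠ 0` in `k`): `3·deg = 5` after specialisation. [elementary] -/
theorem no_cube (h4 : (4 : k) ≠ 0) (H : MvPolynomial (Fin 4) k) (hH : H = MvPolynomial.C 2 * MvPolynomial.X 0 ^ 3 + MvPolynomial.C 3 * MvPolynomial.X 1 ^ 4 +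
      MvPolynomial.C 4 * MvPolynomial.X 2 ^ 5 + MvPolynomial.C 5 * MvPolynomial.X 3 ^ 5) (y : MvPolynomial (Fin 4) k) : y ^ 3 + H ≠ 0 := by
  intro h0
  have h1 := congrArg (MvPolynomial.eval₂Hom (Polynomial.C : k →+* k[X]) (fun m : Fin 4 => if m = 2 then (Polynomial.X : k[X]) else 0)) h0
  rw [map_add, map_pow, spec_H k H hH, map_zero] at h1
  have h2 := congrArg Polynomial.natDegree (eq_neg_of_add_eq_zero_left h1)
  rw [Polynomial.natDegree_pow, Polynomial.natDegree_neg, Polynomial.natDegree_C_mul_X_pow 5 (4 : k) h4] at h2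
  omega

/-- **`G` is not a square in `C`** (`3 ≠ 0` in `k`): `2·deg = 5` after specialisation. [elementary] -/
theorem no_square (h3 : (3 : k) ≠ 0) (G : MvPolynomial (Fin 4) k) (hG : G = MvPolynomial.X 0 ^ 3 + MvPolynomial.C 2 * MvPolynomial.X 1 ^ 4 +
      MvPolynomial.C 3 * MvPolynomial.X 2 ^ 5 + MvPolynomial.C 4 * MvPolynomial.X 3 ^ 5) (y : MvPolynomial (Fin 4) k) : y ^ 2 ≠ G := by
  intro h0
  have h1 := congrArg (MvPolynomial.eval₂Hom (Polynomial.C : k →+* k[X]) (fun m : Fin 4 => if m = 2 then (Polynomial.X : k[X]) else 0)) h0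
  rw [map_pow, spec_G k G hG] at h1
  have h2 := congrArg Polynomial.natDegree h1
  rw [Polynomial.natDegree_pow, Polynomial.natDegree_C_mul_X_pow 5 (3 : k) h3] at h2
  omega

/-! ## §3 `X³ + H` is irreducible over `K₀ = Frac C`; `T₁ = C[X]/(X³ + H)` is a domain -/

/-- `X³ + H` has NO ROOT in `K₀`: a root is integral over the integrally closed (UFD) `C`, so lies in `C` — excluded by `no_cube`. [folklore] -/
theorem no_root_cubic (h4 : (4 : k) ≠ 0) (H : MvPolynomial (Fin 4) k) (hH : H = MvPolynomial.C 2 * MvPolynomial.X 0 ^ 3 + MvPolynomial.C 3 * MvPolynomial.X 1 ^ 4 +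
      MvPolynomial.C 4 * MvPolynomial.X 2 ^ 5 + MvPolynomial.C 5 * MvPolynomial.X 3 ^ 5) (ρ : FractionRing (MvPolynomial (Fin 4) k)) :
    ρ ^ 3 + algebraMap (MvPolynomial (Fin 4) k) (FractionRing (MvPolynomial (Fin 4) k)) H ≠ 0 := by
  intro h0
  have hint : IsIntegral (MvPolynomial (Fin 4) k) ρ := by
    refine ⟨X ^ 3 + Polynomial.C H, Polynomial.monic_X_pow_add_C _ (by norm_num), ?_⟩
    simp only [Polynomial.eval₂_add, Polynomial.eval₂_X_pow, Polynomial.eval₂_C]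
    exact h0
  obtain ⟨y, hy⟩ := IsIntegrallyClosed.algebraMap_eq_of_integral hint
  apply no_cube k h4 H hH y
  apply IsFractionRing.injective (MvPolynomial (Fin 4) k) (FractionRing (MvPolynomial (Fin 4) k))
  rw [map_add, map_pow, hy, h0, map_zero]

/-- `X² − G` has NO ROOT in `K₀` (same mechanism, `no_square`). [folklore] -/
theorem no_root_quadratic (h3 : (3 : k) ≠ 0) (G : MvPolynomial (Fin 4) k) (hG : G = MvPolynomial.X 0 ^ 3 + MvPolynomial.C 2 * MvPolynomial.X 1 ^ 4 +
      MvPolynomial.C 3 * MvPolynomial.X 2 ^ 5 + MvPolynomial.C 4 * MvPolynomial.X 3 ^ 5) (ρ : FractionRing (MvPolynomial (Fin 4) k)) :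
    ρ ^ 2 ≠ algebraMap (MvPolynomial (Fin 4) k) (FractionRing (MvPolynomial (Fin 4) k)) G := by
  intro h0
  have hint : IsIntegral (MvPolynomial (Fin 4) k) ρ := by
    refine ⟨X ^ 2 - Polynomial.C G, Polynomial.monic_X_pow_sub_C _ (by norm_num), ?_⟩
    simp only [Polynomial.eval₂_sub, Polynomial.eval₂_X_pow, Polynomial.eval₂_C]
    rw [h0, sub_self]
  obtain ⟨y, hy⟩ := IsIntegrallyClosed.algebraMap_eq_of_integral hint
  apply no_square k h3 G hG y
  apply IsFractionRing.injective (MvPolynomial (Fin 4) k) (FractionRing (MvPolynomial (Fin 4) k))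
  rw [map_pow, hy, h0]

/-- ★ **`X³ + H` IS IRREDUCIBLE OVER `K₀ = Frac k[x₂..x₅]`** (cubic without a root). [folklore] -/
theorem irreducible_cubic (h4 : (4 : k) ≠ 0) (H : MvPolynomial (Fin 4) k) (hH : H = MvPolynomial.C 2 * MvPolynomial.X 0 ^ 3 + MvPolynomial.C 3 * MvPolynomial.X 1 ^ 4 +
      MvPolynomial.C 4 * MvPolynomial.X 2 ^ 5 + MvPolynomial.C 5 * MvPolynomial.X 3 ^ 5)
    (f₁ : Polynomial (MvPolynomial (Fin 4) k)) (hf₁ : f₁ = X ^ 3 + Polynomial.C H) :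
    Irreducible (f₁.map (algebraMap (MvPolynomial (Fin 4) k) (FractionRing (MvPolynomial (Fin 4) k)))) := by
  have hmap : f₁.map (algebraMap (MvPolynomial (Fin 4) k) (FractionRing (MvPolynomial (Fin 4) k))) =
      X ^ 3 + Polynomial.C (algebraMap (MvPolynomial (Fin 4) k) (FractionRing (MvPolynomial (Fin 4) k)) H) := by
    rw [hf₁, Polynomial.map_add, Polynomial.map_pow, Polynomial.map_X, Polynomial.map_C]
  rw [hmap]
  have hmonic : (X ^ 3 + Polynomial.C (algebraMap (MvPolynomial (Fin 4) k) (FractionRing (MvPolynomial (Fin 4) k)) H)).Monic :=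
    Polynomial.monic_X_pow_add_C _ (by norm_num)
  refine (hmonic.irreducible_iff_roots_eq_zero_of_degree_le_three (by rw [Polynomial.natDegree_X_pow_add_C]; norm_num)
    Polynomial.natDegree_X_pow_add_C.le).mpr (Multiset.eq_zero_iff_forall_notMem.mpr fun ρ hρ => ?_)
  rw [Polynomial.mem_roots hmonic.ne_zero, Polynomial.IsRoot.def, Polynomial.eval_add, Polynomial.eval_pow, Polynomial.eval_X, Polynomial.eval_C] at hρ
  exact no_root_cubic k h4 H hH ρ hρ

/-- `f₁ = X³ + H` is monic of degree `3`. [plumbing] -/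
theorem monic_f₁ (H : MvPolynomial (Fin 4) k) (f₁ : Polynomial (MvPolynomial (Fin 4) k)) (hf₁ : f₁ = X ^ 3 + Polynomial.C H) :
    f₁.Monic ∧ f₁.natDegree = 3 := by
  rw [hf₁]
  exact ⟨Polynomial.monic_X_pow_add_C _ (by norm_num), Polynomial.natDegree_X_pow_add_C⟩

/-- ★ **`T₁ = C[X]/(X³ + H)` IS A DOMAIN.** [folklore] -/
theorem isDomain_T₁ (h4 : (4 : k) ≠ 0) (H : MvPolynomial (Fin 4) k) (hH : H = MvPolynomial.C 2 * MvPolynomial.X 0 ^ 3 + MvPolynomial.C 3 * MvPolynomial.X 1 ^ 4 +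
      MvPolynomial.C 4 * MvPolynomial.X 2 ^ 5 + MvPolynomial.C 5 * MvPolynomial.X 3 ^ 5)
    (f₁ : Polynomial (MvPolynomial (Fin 4) k)) (hf₁ : f₁ = X ^ 3 + Polynomial.C H) : IsDomain (AdjoinRoot f₁) :=
  isDomain_adjoinRoot_of_irreducible_map _ (IsFractionRing.injective (MvPolynomial (Fin 4) k) (FractionRing (MvPolynomial (Fin 4) k))) f₁
    (monic_f₁ k H f₁ hf₁).1 (irreducible_cubic k h4 H hH f₁ hf₁)

/-! ## §4 `X² − G` is irreducible over the cubic field `L₁ = K₀[X]/(X³ + H)`; `T₂ = T₁[X]/(X² − G)` is a domain -/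

/-- ★ **`X² − G` IS IRREDUCIBLE OVER `L₁ = K₀[X]/(X³ + H)`**: a root `σ` would make `G = (N(σ)/G)²` a square in `K₀` (`[L₁ : K₀] = 3`), excluded by `no_root_quadratic`.
[folklore: norm argument] -/
theorem irreducible_quadratic (h3 : (3 : k) ≠ 0) (h4 : (4 : k) ≠ 0)
    (G : MvPolynomial (Fin 4) k) (hG : G = MvPolynomial.X 0 ^ 3 + MvPolynomial.C 2 * MvPolynomial.X 1 ^ 4 +
      MvPolynomial.C 3 * MvPolynomial.X 2 ^ 5 + MvPolynomial.C 4 * MvPolynomial.X 3 ^ 5)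
    (H : MvPolynomial (Fin 4) k) (hH : H = MvPolynomial.C 2 * MvPolynomial.X 0 ^ 3 + MvPolynomial.C 3 * MvPolynomial.X 1 ^ 4 +
      MvPolynomial.C 4 * MvPolynomial.X 2 ^ 5 + MvPolynomial.C 5 * MvPolynomial.X 3 ^ 5)
    (f₁ : Polynomial (MvPolynomial (Fin 4) k)) (hf₁ : f₁ = X ^ 3 + Polynomial.C H)
    (f₂ : Polynomial (AdjoinRoot f₁)) (hf₂ : f₂ = X ^ 2 - Polynomial.C (AdjoinRoot.of f₁ G))
    (ρ₁ : AdjoinRoot f₁ →+* AdjoinRoot (f₁.map (algebraMap (MvPolynomial (Fin 4) k) (FractionRing (MvPolynomial (Fin 4) k)))))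
    (hρ₁C : ∀ d, ρ₁ (AdjoinRoot.of f₁ d) = AdjoinRoot.of _ (algebraMap (MvPolynomial (Fin 4) k) (FractionRing (MvPolynomial (Fin 4) k)) d)) :
    Irreducible (f₂.map ρ₁) := by
  haveI : Fact (Irreducible (f₁.map (algebraMap (MvPolynomial (Fin 4) k) (FractionRing (MvPolynomial (Fin 4) k))))) :=
    ⟨irreducible_cubic k h4 H hH f₁ hf₁⟩
  set γ : FractionRing (MvPolynomial (Fin 4) k) := algebraMap (MvPolynomial (Fin 4) k) (FractionRing (MvPolynomial (Fin 4) k)) G with hγdef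
  have hmap : f₂.map ρ₁ = X ^ 2 - Polynomial.C (algebraMap (FractionRing (MvPolynomial (Fin 4) k)) _ γ) := by
    rw [hf₂, Polynomial.map_sub, Polynomial.map_pow, Polynomial.map_X, Polynomial.map_C, hρ₁C, AdjoinRoot.algebraMap_eq]
  rw [hmap]
  have hmonic := Polynomial.monic_X_pow_sub_C (algebraMap (FractionRing (MvPolynomial (Fin 4) k))
    (AdjoinRoot (f₁.map (algebraMap (MvPolynomial (Fin 4) k) (FractionRing (MvPolynomial (Fin 4) k))))) γ) (two_ne_zero)
  refine (hmonic.irreducible_iff_roots_eq_zero_of_degree_le_three Polynomial.natDegree_X_pow_sub_C.ge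
    (by rw [Polynomial.natDegree_X_pow_sub_C]; norm_num)).mpr (Multiset.eq_zero_iff_forall_notMem.mpr fun σ hσ => ?_)
  rw [Polynomial.mem_roots hmonic.ne_zero, Polynomial.IsRoot.def, Polynomial.eval_sub, Polynomial.eval_pow, Polynomial.eval_X, Polynomial.eval_C,
    sub_eq_zero] at hσ
  have hfin : Module.finrank (FractionRing (MvPolynomial (Fin 4) k))
      (AdjoinRoot (f₁.map (algebraMap (MvPolynomial (Fin 4) k) (FractionRing (MvPolynomial (Fin 4) k))))) = 3 := by
    rw [(AdjoinRoot.powerBasis (Fact.out : Irreducible (f₁.map (algebraMap (MvPolynomial (Fin 4) k)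
      (FractionRing (MvPolynomial (Fin 4) k))))).ne_zero).finrank, AdjoinRoot.powerBasis_dim, (monic_f₁ k H f₁ hf₁).1.natDegree_map,
      (monic_f₁ k H f₁ hf₁).2]
  have hG0 : G ≠ 0 := fun hG0 => no_square k h3 G hG 0 (by rw [hG0]; ring)
  have hγ : γ ≠ 0 := (map_ne_zero_iff _ (IsFractionRing.injective (MvPolynomial (Fin 4) k) (FractionRing (MvPolynomial (Fin 4) k)))).mpr hG0
  exact no_root_quadratic k h3 G hG _ (sq_eq_of_sq_eq_algebraMap hfin γ hγ σ hσ)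

/-- ★ **`T₂ = T₁[X]/(X² − G)` IS A DOMAIN.** [folklore] -/
theorem isDomain_T₂ (h3 : (3 : k) ≠ 0) (h4 : (4 : k) ≠ 0)
    (G : MvPolynomial (Fin 4) k) (hG : G = MvPolynomial.X 0 ^ 3 + MvPolynomial.C 2 * MvPolynomial.X 1 ^ 4 +
      MvPolynomial.C 3 * MvPolynomial.X 2 ^ 5 + MvPolynomial.C 4 * MvPolynomial.X 3 ^ 5)
    (H : MvPolynomial (Fin 4) k) (hH : H = MvPolynomial.C 2 * MvPolynomial.X 0 ^ 3 + MvPolynomial.C 3 * MvPolynomial.X 1 ^ 4 +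
      MvPolynomial.C 4 * MvPolynomial.X 2 ^ 5 + MvPolynomial.C 5 * MvPolynomial.X 3 ^ 5)
    (f₁ : Polynomial (MvPolynomial (Fin 4) k)) (hf₁ : f₁ = X ^ 3 + Polynomial.C H)
    (f₂ : Polynomial (AdjoinRoot f₁)) (hf₂ : f₂ = X ^ 2 - Polynomial.C (AdjoinRoot.of f₁ G)) : IsDomain (AdjoinRoot f₂) := by
  haveI : Fact (Irreducible (f₁.map (algebraMap (MvPolynomial (Fin 4) k) (FractionRing (MvPolynomial (Fin 4) k))))) :=
    ⟨irreducible_cubic k h4 H hH f₁ hf₁⟩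
  obtain ⟨ρ₁, hρ₁C, hρ₁X⟩ := exists_hom_of_monic (algebraMap (MvPolynomial (Fin 4) k) (FractionRing (MvPolynomial (Fin 4) k))) f₁
  have hinj := injective_of_monic _ (IsFractionRing.injective (MvPolynomial (Fin 4) k) (FractionRing (MvPolynomial (Fin 4) k))) f₁
    (monic_f₁ k H f₁ hf₁).1 ρ₁ hρ₁C hρ₁X
  have hmonic₂ : f₂.Monic := by rw [hf₂]; exact Polynomial.monic_X_pow_sub_C _ two_ne_zero
  exact isDomain_adjoinRoot_of_irreducible_map ρ₁ hinj f₂ hmonic₂ (irreducible_quadratic k h3 h4 G hG H hH f₁ hf₁ f₂ hf₂ ρ₁ hρ₁C)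

/-! ## §5 ★ `(F₁, F₂)` is prime: `Φ : k[x₀..x₅] → T₂`, its left inverse `Ψ` modulo `(F₁, F₂)`, `ker Φ = (F₁, F₂)` -/

/-- `X̄³ + H = 0` in `T₁`. [plumbing] -/
theorem root₁_rel (H : MvPolynomial (Fin 4) k) (f₁ : Polynomial (MvPolynomial (Fin 4) k)) (hf₁ : f₁ = X ^ 3 + Polynomial.C H) :
    AdjoinRoot.root f₁ ^ 3 + AdjoinRoot.of f₁ H = 0 := by
  have h : (X ^ 3 + Polynomial.C H).eval₂ (AdjoinRoot.of f₁) (AdjoinRoot.root f₁) = 0 := by rw [← hf₁]; exact AdjoinRoot.eval₂_root f₁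
  rwa [Polynomial.eval₂_add, Polynomial.eval₂_X_pow, Polynomial.eval₂_C] at h

/-- `X̄² = G` in `T₂`. [plumbing] -/
theorem root₂_rel (G : MvPolynomial (Fin 4) k) (f₁ : Polynomial (MvPolynomial (Fin 4) k)) (f₂ : Polynomial (AdjoinRoot f₁))
    (hf₂ : f₂ = X ^ 2 - Polynomial.C (AdjoinRoot.of f₁ G)) : AdjoinRoot.root f₂ ^ 2 = AdjoinRoot.of f₂ (AdjoinRoot.of f₁ G) := by
  have h : (X ^ 2 - Polynomial.C (AdjoinRoot.of f₁ G)).eval₂ (AdjoinRoot.of f₂) (AdjoinRoot.root f₂) = 0 := by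
    rw [← hf₂]; exact AdjoinRoot.eval₂_root f₂
  rwa [Polynomial.eval₂_sub, Polynomial.eval₂_X_pow, Polynomial.eval₂_C, sub_eq_zero] at h

/-- ★ **THE LEFT INVERSE `Ψ : T₂ → k[x]/I`** (universal properties of the two monic extensions): it exists as soon as `I ∋ Q = x₁³ + H(x₂..x₅)` and
`I ∋ P = x₀² − G(x₂..x₅)`; `Ψ(X̄₂) = x̄₀`, `Ψ(X̄₁) = x̄₁`, `Ψ(y_m) = x̄_{m+2}`, `Ψ(a) = ā`. [folklore] -/
theorem exists_leftInv (G : MvPolynomial (Fin 4) k) (hG : G = MvPolynomial.X 0 ^ 3 + MvPolynomial.C 2 * MvPolynomial.X 1 ^ 4 +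
      MvPolynomial.C 3 * MvPolynomial.X 2 ^ 5 + MvPolynomial.C 4 * MvPolynomial.X 3 ^ 5)
    (H : MvPolynomial (Fin 4) k) (hH : H = MvPolynomial.C 2 * MvPolynomial.X 0 ^ 3 + MvPolynomial.C 3 * MvPolynomial.X 1 ^ 4 +
      MvPolynomial.C 4 * MvPolynomial.X 2 ^ 5 + MvPolynomial.C 5 * MvPolynomial.X 3 ^ 5)
    (f₁ : Polynomial (MvPolynomial (Fin 4) k)) (hf₁ : f₁ = X ^ 3 + Polynomial.C H)
    (f₂ : Polynomial (AdjoinRoot f₁)) (hf₂ : f₂ = X ^ 2 - Polynomial.C (AdjoinRoot.of f₁ G)) (I : Ideal (MvPolynomial (Fin 6) k))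
    (hQ : (MvPolynomial.X 1 ^ 3 + (MvPolynomial.C 2 * MvPolynomial.X 2 ^ 3 + MvPolynomial.C 3 * MvPolynomial.X 3 ^ 4 + MvPolynomial.C 4 * MvPolynomial.X 4 ^ 5 +
      MvPolynomial.C 5 * MvPolynomial.X 5 ^ 5) : MvPolynomial (Fin 6) k) ∈ I)
    (hP : (MvPolynomial.X 0 ^ 2 - (MvPolynomial.X 2 ^ 3 + MvPolynomial.C 2 * MvPolynomial.X 3 ^ 4 + MvPolynomial.C 3 * MvPolynomial.X 4 ^ 5 +
      MvPolynomial.C 4 * MvPolynomial.X 5 ^ 5) : MvPolynomial (Fin 6) k) ∈ I) :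
    ∃ Ψ : AdjoinRoot f₂ →+* MvPolynomial (Fin 6) k ⧸ I,
      (∀ a : k, Ψ (AdjoinRoot.of f₂ (AdjoinRoot.of f₁ (MvPolynomial.C a))) = Ideal.Quotient.mk I (MvPolynomial.C a)) ∧
      Ψ (AdjoinRoot.root f₂) = Ideal.Quotient.mk I (MvPolynomial.X 0) ∧
      Ψ (AdjoinRoot.of f₂ (AdjoinRoot.root f₁)) = Ideal.Quotient.mk I (MvPolynomial.X 1) ∧
      ∀ m : Fin 4, Ψ (AdjoinRoot.of f₂ (AdjoinRoot.of f₁ (MvPolynomial.X m))) =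
        Ideal.Quotient.mk I (![MvPolynomial.X 2, MvPolynomial.X 3, MvPolynomial.X 4, MvPolynomial.X 5] m) := by
  set ψ₀ : MvPolynomial (Fin 4) k →+* MvPolynomial (Fin 6) k ⧸ I := MvPolynomial.eval₂Hom ((Ideal.Quotient.mk I).comp MvPolynomial.C)
    (fun m : Fin 4 => Ideal.Quotient.mk I (![MvPolynomial.X 2, MvPolynomial.X 3, MvPolynomial.X 4, MvPolynomial.X 5] m)) with hψ₀
  have hψ₀C : ∀ a : k, ψ₀ (MvPolynomial.C a) = Ideal.Quotient.mk I (MvPolynomial.C a) := fun a => by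
    rw [hψ₀, MvPolynomial.eval₂Hom_C, RingHom.comp_apply]
  have hψ₀X : ∀ m : Fin 4, ψ₀ (MvPolynomial.X m) = Ideal.Quotient.mk I (![MvPolynomial.X 2, MvPolynomial.X 3, MvPolynomial.X 4, MvPolynomial.X 5] m) :=
    fun m => by rw [hψ₀, MvPolynomial.eval₂Hom_X']
  have hψ₀H : ψ₀ H = Ideal.Quotient.mk I (MvPolynomial.C 2 * MvPolynomial.X 2 ^ 3 + MvPolynomial.C 3 * MvPolynomial.X 3 ^ 4 +
      MvPolynomial.C 4 * MvPolynomial.X 4 ^ 5 + MvPolynomial.C 5 * MvPolynomial.X 5 ^ 5) := by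
    rw [hH]
    simp only [map_add, map_mul, map_pow, hψ₀C, hψ₀X, Matrix.cons_val_zero, Matrix.cons_val_one, Matrix.cons_val]
  have hψ₀G : ψ₀ G = Ideal.Quotient.mk I (MvPolynomial.X 2 ^ 3 + MvPolynomial.C 2 * MvPolynomial.X 3 ^ 4 + MvPolynomial.C 3 * MvPolynomial.X 4 ^ 5 +
      MvPolynomial.C 4 * MvPolynomial.X 5 ^ 5) := by
    rw [hG]
    simp only [map_add, map_mul, map_pow, hψ₀C, hψ₀X, Matrix.cons_val_zero, Matrix.cons_val_one, Matrix.cons_val]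
  have h₁ : f₁.eval₂ ψ₀ (Ideal.Quotient.mk I (MvPolynomial.X 1)) = 0 := by
    rw [hf₁, Polynomial.eval₂_add, Polynomial.eval₂_X_pow, Polynomial.eval₂_C, hψ₀H, ← map_pow, ← map_add]
    exact Ideal.Quotient.eq_zero_iff_mem.mpr hQ
  set ψ₁ : AdjoinRoot f₁ →+* MvPolynomial (Fin 6) k ⧸ I := AdjoinRoot.lift ψ₀ (Ideal.Quotient.mk I (MvPolynomial.X 1)) h₁ with hψ₁
  have h₂ : f₂.eval₂ ψ₁ (Ideal.Quotient.mk I (MvPolynomial.X 0)) = 0 := by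
    rw [hf₂, Polynomial.eval₂_sub, Polynomial.eval₂_X_pow, Polynomial.eval₂_C, hψ₁, AdjoinRoot.lift_of, hψ₀G, ← map_pow, ← map_sub]
    exact Ideal.Quotient.eq_zero_iff_mem.mpr hP
  refine ⟨AdjoinRoot.lift ψ₁ (Ideal.Quotient.mk I (MvPolynomial.X 0)) h₂, fun a => ?_, ?_, ?_, fun m => ?_⟩
  · rw [AdjoinRoot.lift_of, hψ₁, AdjoinRoot.lift_of, hψ₀C]
  · rw [AdjoinRoot.lift_root]
  · rw [AdjoinRoot.lift_of, hψ₁, AdjoinRoot.lift_root]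
  · rw [AdjoinRoot.lift_of, hψ₁, AdjoinRoot.lift_of, hψ₀X]

/-- ★★ **`(F₁, F₂) ⊂ k[x₀, …, x₅]` IS PRIME** for `F₁ = x₀²+x₁³+x₂³+x₃⁴+x₄⁵+x₅⁵`, `F₂ = x₀²+2x₁³+3x₂³+4x₃⁴+5x₄⁵+6x₅⁵` when `3, 4 ≠ 0` in `k` (so for every field of
characteristic `≥ 7`): `k[x]/(F₁, F₂) ↪ T₂ = k[x₂..x₅][X̄₁][X̄₂]`, a domain (§1–§4). See the module docstring.
[OURS · elementary certificate; folklore] -/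
theorem isPrime_span_pair (h3 : (3 : k) ≠ 0) (h4 : (4 : k) ≠ 0) (F : Fin 2 → MvPolynomial (Fin 6) k)
    (hF0 : F 0 = MvPolynomial.X 0 ^ 2 + MvPolynomial.X 1 ^ 3 + MvPolynomial.X 2 ^ 3 + MvPolynomial.X 3 ^ 4 + MvPolynomial.X 4 ^ 5 + MvPolynomial.X 5 ^ 5)
    (hF1 : F 1 = MvPolynomial.X 0 ^ 2 + MvPolynomial.C 2 * MvPolynomial.X 1 ^ 3 + MvPolynomial.C 3 * MvPolynomial.X 2 ^ 3 +
      MvPolynomial.C 4 * MvPolynomial.X 3 ^ 4 + MvPolynomial.C 5 * MvPolynomial.X 4 ^ 5 + MvPolynomial.C 6 * MvPolynomial.X 5 ^ 5) :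
    (Ideal.span (Set.range F)).IsPrime := by
  obtain ⟨G, hG⟩ : ∃ G : MvPolynomial (Fin 4) k, G = MvPolynomial.X 0 ^ 3 + MvPolynomial.C 2 * MvPolynomial.X 1 ^ 4 +
      MvPolynomial.C 3 * MvPolynomial.X 2 ^ 5 + MvPolynomial.C 4 * MvPolynomial.X 3 ^ 5 := ⟨_, rfl⟩
  obtain ⟨H, hH⟩ : ∃ H : MvPolynomial (Fin 4) k, H = MvPolynomial.C 2 * MvPolynomial.X 0 ^ 3 + MvPolynomial.C 3 * MvPolynomial.X 1 ^ 4 +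
      MvPolynomial.C 4 * MvPolynomial.X 2 ^ 5 + MvPolynomial.C 5 * MvPolynomial.X 3 ^ 5 := ⟨_, rfl⟩
  obtain ⟨f₁, hf₁⟩ : ∃ f₁ : Polynomial (MvPolynomial (Fin 4) k), f₁ = X ^ 3 + Polynomial.C H := ⟨_, rfl⟩
  obtain ⟨f₂, hf₂⟩ : ∃ f₂ : Polynomial (AdjoinRoot f₁), f₂ = X ^ 2 - Polynomial.C (AdjoinRoot.of f₁ G) := ⟨_, rfl⟩
  haveI := isDomain_T₂ k h3 h4 G hG H hH f₁ hf₁ f₂ hf₂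
  set I : Ideal (MvPolynomial (Fin 6) k) := Ideal.span (Set.range F) with hI
  -- `Φ : k[x] → T₂`
  set Φ : MvPolynomial (Fin 6) k →+* AdjoinRoot f₂ := MvPolynomial.eval₂Hom ((AdjoinRoot.of f₂).comp ((AdjoinRoot.of f₁).comp MvPolynomial.C))
    ![AdjoinRoot.root f₂, AdjoinRoot.of f₂ (AdjoinRoot.root f₁), AdjoinRoot.of f₂ (AdjoinRoot.of f₁ (MvPolynomial.X 0)),
      AdjoinRoot.of f₂ (AdjoinRoot.of f₁ (MvPolynomial.X 1)), AdjoinRoot.of f₂ (AdjoinRoot.of f₁ (MvPolynomial.X 2)),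
      AdjoinRoot.of f₂ (AdjoinRoot.of f₁ (MvPolynomial.X 3))] with hΦ
  suffices hker : RingHom.ker Φ = I by rw [← hker]; exact RingHom.ker_isPrime Φ
  -- `Φ` kills `F₀, F₁`
  have hR₁ := congrArg (AdjoinRoot.of f₂) (root₁_rel k H f₁ hf₁)
  have hR₂ := root₂_rel k G f₁ f₂ hf₂
  rw [hH, map_zero] at hR₁
  rw [hG] at hR₂
  simp only [map_add, map_mul, map_pow, map_ofNat] at hR₁ hR₂
  have hΦC : ∀ a : k, Φ (MvPolynomial.C a) = AdjoinRoot.of f₂ (AdjoinRoot.of f₁ (MvPolynomial.C a)) := fun a => by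
    rw [hΦ, MvPolynomial.eval₂Hom_C, RingHom.comp_apply, RingHom.comp_apply]
  have hΦX : ∀ i : Fin 6, Φ (MvPolynomial.X i) = ![AdjoinRoot.root f₂, AdjoinRoot.of f₂ (AdjoinRoot.root f₁),
      AdjoinRoot.of f₂ (AdjoinRoot.of f₁ (MvPolynomial.X 0)), AdjoinRoot.of f₂ (AdjoinRoot.of f₁ (MvPolynomial.X 1)),
      AdjoinRoot.of f₂ (AdjoinRoot.of f₁ (MvPolynomial.X 2)), AdjoinRoot.of f₂ (AdjoinRoot.of f₁ (MvPolynomial.X 3))] i := fun i => by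
    rw [hΦ, MvPolynomial.eval₂Hom_X']
  have hΦ0 : Φ (F 0) = 0 := by
    rw [hF0]
    simp only [map_add, map_pow, hΦX, Matrix.cons_val_zero, Matrix.cons_val_one, Matrix.cons_val]
    linear_combination hR₂ + hR₁
  have hΦ1 : Φ (F 1) = 0 := by
    rw [hF1]
    simp only [map_add, map_mul, map_pow, map_ofNat, hΦX, Matrix.cons_val_zero, Matrix.cons_val_one, Matrix.cons_val]
    linear_combination hR₂ + 2 * hR₁
  -- the left inverse
  have hQ : (MvPolynomial.X 1 ^ 3 + (MvPolynomial.C 2 * MvPolynomial.X 2 ^ 3 + MvPolynomial.C 3 * MvPolynomial.X 3 ^ 4 + MvPolynomial.C 4 * MvPolynomial.X 4 ^ 5 +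
      MvPolynomial.C 5 * MvPolynomial.X 5 ^ 5) : MvPolynomial (Fin 6) k) ∈ I := by
    have e : (MvPolynomial.X 1 ^ 3 + (MvPolynomial.C 2 * MvPolynomial.X 2 ^ 3 + MvPolynomial.C 3 * MvPolynomial.X 3 ^ 4 + MvPolynomial.C 4 * MvPolynomial.X 4 ^ 5 +
        MvPolynomial.C 5 * MvPolynomial.X 5 ^ 5) : MvPolynomial (Fin 6) k) = F 1 - F 0 := by
      rw [hF0, hF1]; simp only [map_ofNat]; ring
    rw [e]
    exact I.sub_mem (Ideal.subset_span ⟨1, rfl⟩) (Ideal.subset_span ⟨0, rfl⟩)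
  have hP : (MvPolynomial.X 0 ^ 2 - (MvPolynomial.X 2 ^ 3 + MvPolynomial.C 2 * MvPolynomial.X 3 ^ 4 + MvPolynomial.C 3 * MvPolynomial.X 4 ^ 5 +
      MvPolynomial.C 4 * MvPolynomial.X 5 ^ 5) : MvPolynomial (Fin 6) k) ∈ I := by
    have e : (MvPolynomial.X 0 ^ 2 - (MvPolynomial.X 2 ^ 3 + MvPolynomial.C 2 * MvPolynomial.X 3 ^ 4 + MvPolynomial.C 3 * MvPolynomial.X 4 ^ 5 +
        MvPolynomial.C 4 * MvPolynomial.X 5 ^ 5) : MvPolynomial (Fin 6) k) = MvPolynomial.C 2 * F 0 - F 1 := by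
      rw [hF0, hF1]; simp only [map_ofNat]; ring
    rw [e]
    exact I.sub_mem (I.mul_mem_left _ (Ideal.subset_span ⟨0, rfl⟩)) (Ideal.subset_span ⟨1, rfl⟩)
  obtain ⟨Ψ, hΨC, hΨ0, hΨ1, hΨY⟩ := exists_leftInv k G hG H hH f₁ hf₁ f₂ hf₂ I hQ hP
  have hcomp : Ψ.comp Φ = Ideal.Quotient.mk I := by
    refine MvPolynomial.ringHom_ext (fun a => ?_) (fun i => ?_)
    · rw [RingHom.comp_apply, hΦC, hΨC]
    · rw [RingHom.comp_apply, hΦX]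
      fin_cases i
      · simpa using hΨ0
      · simpa using hΨ1
      · simpa using hΨY 0
      · simpa using hΨY 1
      · simpa using hΨY 2
      · simpa using hΨY 3
  refine le_antisymm (fun g hg => ?_) (Ideal.span_le.mpr ?_)
  · rw [RingHom.mem_ker] at hg
    rw [← Ideal.Quotient.eq_zero_iff_mem, ← hcomp, RingHom.comp_apply, hg, map_zero]
  · rintro _ ⟨l, rfl⟩
    rw [SetLike.mem_coe, RingHom.mem_ker]
    fin_cases l
    · exact hΦ0
    · exact hΦ1

end Summit.ResolutionOfSingularities.ResolutionOfSingularities.Theorems.FInjectiveMacaulayfication.DiagonalBPCIPrime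

end
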